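import Summits.QuantumFields.BalabanUV.Beta.GAN24.TaylorRowLamTable
import Summits.QuantumFields.BalabanUV.Beta.GAN24.TaylorSandwich

/-!
# `BalabanUV.Beta.GAN24.TaylorDiffLam` — binder row G-an2-4 / (CONV-C), S-slot, road «S3-Taylor», DIFF row R3-dL (typer `LEAVES.md` v3.3
# PART III § III.R, holder `b2b-balaban-gan24-formalise-leaf-11-g15`, INTENT «ROW-dL*» journal l.5338), part 1 (generic `d`): THE THREE-LEG
# TELESCOPING OF A ONE-CHANNEL THIRD-JET UNIT SANDWICH, WITH THE BOUND — `A′H′B′ − AHB = (A′−A)H′B′ + A(H′−H)B′ + AH(B′−B)` under the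
# outer `y`-sum, each term an instance of the owner's `TaylorSandwich.sandwich_bound`; and its instance for the Λ table of rows S3-L ∕ R3-dL

NOT IN PRINT; OUR BOOKKEEPING.  HONEST FRAMING (cell contract, verbatim): «discharging `BetaPertH` makes Bałaban's UV stability UNCONDITIONAL —
a real constructive-QFT result; it is NOT the continuum limit and NOT the Clay problem.»  HONEST DEPENDENCY (verbatim): «continuum YM on T⁴ ⇐
BetaPertH ∧ nine spine estimates (0/9 proved); BetaPertH ⇐ (D1) ∧ (D4) ∧ CAP+tail; G-an2-4 gates asym, D1 and NE2/3/4.»  [folklore] real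
analysis on `ℤ^{d+1}` over the owner's `TaylorSandwich` (p206132) and leaf-18's `TaylorRowLamTable` (p207200) BY NAME: cites nothing, mints no
`def … : Prop`, defines nothing; no object of an1∕an2∕an3 is estimated (the legs `A, B, H` are ABSTRACT functions with stated block-`ℓ¹` bounds).
Discharges NOTHING of «E3Shape»∕«E3SupRate», (hS, hSall), row R3-dL itself; NOT BetaPertH, NOT continuum, NOT Clay.

## Why (context only; asserted nowhere below)
The DIFF rows of the S3 RATE table (`StencilSlotE3RateOfPieces.e3SupRate_of_pieces`: dV, dL, …) compare the SAME finite table read through the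
normalised legs of two consecutive members (after the dilation alignment «DILATE*» ∕ «SANDWICH-DECIMATE*»); the difference of two such sandwiches
is the sum of THREE sandwiches, each with exactly one DIFFERENCE leg (two-level leg comparison: «(N1-Cauchy)» for `H̃`∕`G̃`, the K-slot's
`CauchyDecayK` for `Φ̃`) and two undifferenced legs — so the row's rate is read off `sandwich_bound` three times.  This file is that bookkeeping.

## Contents ([folklore]; `d` generic; sandwiches in `TaylorSandwich.sandwich_bound`'s LITERAL nesting)
§1 `term_eq_finset` (finite-support form of the `y`-term), **`term_sub₃`** (exact three-leg telescoping of the `y`-term), **`sandwich_sub_le`**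
   (generic table `T` with the owner's support∕mass hypotheses: `|SW(A′,H′,B′) − SW(A,H,B)| ≤ (d+1)·(dA·CB′·CH′ + CA·CB′·dH + CA·dB·CH)·Mass·K_W·K_U·
   Zl_{d+1}(κ∕2)·e^{−(κ∕2)(|x′−u′|₁+|z′−u′|₁)}`; summability of all five sandwiches by `sandwich_summable`).
§2 `sandwich_const_mul_vertex` (a scalar on the vertex leg factors out; `tsum_mul_left`, unconditional over `ℝ`), pointwise linearity of `𝒬ᵀ_R`
   and `onLat` (`contourSumAdj_sub`, `contourSumAdj_const_mul`, `onLat_sub_apply`, `onLat_const_mul_apply`), and **`abs_onLat_contourSumAdj_le`**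
   — the vertex leg `onLat N′ (e·𝒬ᵀ_R φ μ)` of a GENERIC coarse 1-form `φ` decaying from `u′` (twin of leaf-18's `abs_vertexLeg_le`, which is the
   instance `φ = Φ̃_N(· − u′)`; here `φ` will be a one-step DIFFERENCE of multiplier legs).
§3 **`lamSandwich_sub_le`** — §1 for the Λ table `onLat (Lc^{ℓ+1}) (avgLift (Lc^ℓ) ∘ hessFF Lc μ)` of `TaylorRowLamInner.inner_eq` with
   ABSTRACT legs (member `N = Lc^{ℓ+k+1}`), supports∕mass from leaf-18's `mem_boxW_of_ne_zero` ∕ `mem_imageY_of_ne_zero` ∕ `table_mass_le`.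
-/

noncomputable section

open Finset
open scoped BigOperators
open Literature.MathematicalPhysics.QuantumFieldTheory
open Literature.MathematicalPhysics.QuantumFieldTheory.Balaban1983to89
open Literature.MathematicalPhysics.QuantumFieldTheory.Balaban1983to89.Beta
open Literature.Probability.LatticeModels (Torus.proj Torus.proj_apply)
open AffineAveraging (Site)
open LatticeForm (quo)
open B12Sec2to5 (l1 l1_nonneg)
open ExpKernelCalculus (MKer Zl BiLoc l1_sub_triangle l1_sub_symm l1_natSmul)
open OneStepResolventKernel (Fib KInv LocStencil proj_zsmul quo_zsmul)
open InterLevelTransport (avgLift onLat onLat_zsmul onLat_off)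
open AveragingHessianKernels (hessFF ell)
open Summit.QuantumFields.BalabanUV.Beta.GAN24.TaylorSandwich (sandwich_bound sandwich_summable tsum_u_eq_sum tsum_w_eq_sum)
open Summit.QuantumFields.BalabanUV.Beta.GAN24.TaylorRowLam (table_mass_le mem_boxW_of_ne_zero mem_imageY_of_ne_zero l1_le_of_mem_imageY
  l1_le_of_mem_box)

namespace Summit.QuantumFields.BalabanUV.Beta.GAN24.TaylorDiffLam

variable {d : ℕ} {Lc : ℕ} [NeZero Lc]

/-! ## §1 Three-leg telescoping of a one-channel sandwich (generic table) -/

section Trilinear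

variable {N : ℕ} [NeZero N] {κ CA CB CH CA' CB' CH' dA dB dH Mass RW RU : ℝ} {x' u' z' : Site (d + 1)}
  {A B H A' B' H' : Fin (d + 1) → Site (d + 1) → ℝ}
  {T : Fin (d + 1) → Site (d + 1) → Site (d + 1) → Fin (d + 1) → Site (d + 1) → Fin (d + 1) → ℝ}
  {Sw Su : Site (d + 1) → Finset (Site (d + 1))}

/-- [folklore] Finite-support form of the `y`-term of the sandwich (both inner `tsum`s are finite sums over the column supports). -/
theorem term_eq_finset (hTw : ∀ κ'' u w l y l', T κ'' u w l y l' ≠ 0 → w ∈ Sw y)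
    (hTu : ∀ κ'' u w l y l', T κ'' u w l y l' ≠ 0 → u ∈ Su y) (c : ℝ)
    (A₀ H₀ B₀ : Fin (d + 1) → Site (d + 1) → ℝ) (y : Site (d + 1)) :
    ∑ l', (∑' w, ∑ l, A₀ l w * ∑ μ, c * ∑' v, H₀ μ v * T μ v w l y l') * B₀ l' y =
      ∑ l', (∑ w ∈ Sw y, ∑ l, A₀ l w * ∑ μ, c * ∑ v ∈ Su y, H₀ μ v * T μ v w l y l') * B₀ l' y := by
  refine Finset.sum_congr rfl fun l' _ => ?_
  rw [tsum_w_eq_sum (A := A₀) (H := H₀) hTw c y l']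
  congr 1
  refine Finset.sum_congr rfl fun w _ => Finset.sum_congr rfl fun l _ => ?_
  congr 1
  refine Finset.sum_congr rfl fun μ _ => ?_
  rw [tsum_u_eq_sum (H := H₀) hTu]

/-- [folklore] **THREE-LEG TELESCOPING OF THE `y`-TERM**: `A′H′B′ − AHB = (A′−A)H′B′ + A(H′−H)B′ + AH(B′−B)` inside the sandwich's `y`-term
(exact; the inner sums are finite by the column supports). -/
theorem term_sub₃ (hTw : ∀ κ'' u w l y l', T κ'' u w l y l' ≠ 0 → w ∈ Sw y)
    (hTu : ∀ κ'' u w l y l', T κ'' u w l y l' ≠ 0 → u ∈ Su y) (c : ℝ) (y : Site (d + 1)) :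
    (∑ l', (∑' w, ∑ l, A' l w * ∑ μ, c * ∑' v, H' μ v * T μ v w l y l') * B' l' y) -
        (∑ l', (∑' w, ∑ l, A l w * ∑ μ, c * ∑' v, H μ v * T μ v w l y l') * B l' y) =
      (∑ l', (∑' w, ∑ l, (A' l w - A l w) * ∑ μ, c * ∑' v, H' μ v * T μ v w l y l') * B' l' y) +
      (∑ l', (∑' w, ∑ l, A l w * ∑ μ, c * ∑' v, (H' μ v - H μ v) * T μ v w l y l') * B' l' y) +
      (∑ l', (∑' w, ∑ l, A l w * ∑ μ, c * ∑' v, H μ v * T μ v w l y l') * (B' l' y - B l' y)) := by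
  rw [term_eq_finset hTw hTu c A' H' B' y, term_eq_finset hTw hTu c A H B y,
    term_eq_finset hTw hTu c (fun l w => A' l w - A l w) H' B' y,
    term_eq_finset hTw hTu c A (fun μ v => H' μ v - H μ v) B' y,
    term_eq_finset hTw hTu c A H (fun l' y => B' l' y - B l' y) y]
  have e1 : ∀ l', (∑ w ∈ Sw y, ∑ l, (A' l w - A l w) * ∑ μ, c * ∑ v ∈ Su y, H' μ v * T μ v w l y l') =
      (∑ w ∈ Sw y, ∑ l, A' l w * ∑ μ, c * ∑ v ∈ Su y, H' μ v * T μ v w l y l') -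
        (∑ w ∈ Sw y, ∑ l, A l w * ∑ μ, c * ∑ v ∈ Su y, H' μ v * T μ v w l y l') := by
    intro l'
    rw [← Finset.sum_sub_distrib]
    refine Finset.sum_congr rfl fun w _ => ?_
    rw [← Finset.sum_sub_distrib]
    refine Finset.sum_congr rfl fun l _ => ?_
    ring
  have e2 : ∀ l', (∑ w ∈ Sw y, ∑ l, A l w * ∑ μ, c * ∑ v ∈ Su y, (H' μ v - H μ v) * T μ v w l y l') =
      (∑ w ∈ Sw y, ∑ l, A l w * ∑ μ, c * ∑ v ∈ Su y, H' μ v * T μ v w l y l') -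
        (∑ w ∈ Sw y, ∑ l, A l w * ∑ μ, c * ∑ v ∈ Su y, H μ v * T μ v w l y l') := by
    intro l'
    rw [← Finset.sum_sub_distrib]
    refine Finset.sum_congr rfl fun w _ => ?_
    rw [← Finset.sum_sub_distrib]
    refine Finset.sum_congr rfl fun l _ => ?_
    rw [← mul_sub, ← Finset.sum_sub_distrib]
    congr 1
    refine Finset.sum_congr rfl fun μ _ => ?_
    rw [← mul_sub, ← Finset.sum_sub_distrib]
    congr 1
    refine Finset.sum_congr rfl fun v _ => ?_
    ring
  simp_rw [e1, e2]
  rw [← Finset.sum_sub_distrib, ← Finset.sum_add_distrib, ← Finset.sum_add_distrib]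
  refine Finset.sum_congr rfl fun l' _ => ?_
  ring

/-- [folklore] **THREE-LEG TELESCOPING OF THE SANDWICH, WITH THE BOUND**: if both leg triples `(A, H, B)`, `(A′, H′, B′)` and the three
difference legs `A′−A`, `H′−H`, `B′−B` are in `sandwich_bound`'s currency (one rate `κ`; constants `CA, CH, CB`, `CA′, CH′, CB′`, `dA, dH, dB`),
then `|SW(A′,H′,B′) − SW(A,H,B)| ≤ (d+1)·(dA·CB′·CH′ + CA·CB′·dH + CA·dB·CH)·Mass·K_W·K_U·Zl_{d+1}(κ∕2)·e^{−(κ∕2)(|x′−u′|₁+|z′−u′|₁)}`. -/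
theorem sandwich_sub_le (hκ : 0 < κ)
    (hA : ∀ l w, |A l w| ≤ CA * Real.exp (-κ * l1 (x' - quo N w)))
    (hB : ∀ l' y, |B l' y| ≤ CB * Real.exp (-κ * l1 (quo N y - z')))
    (hH : ∀ κ'' u, |H κ'' u| ≤ CH * Real.exp (-κ * l1 (quo N u - u')))
    (hA' : ∀ l w, |A' l w| ≤ CA' * Real.exp (-κ * l1 (x' - quo N w)))
    (hB' : ∀ l' y, |B' l' y| ≤ CB' * Real.exp (-κ * l1 (quo N y - z')))
    (hH' : ∀ κ'' u, |H' κ'' u| ≤ CH' * Real.exp (-κ * l1 (quo N u - u')))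
    (hdA : ∀ l w, |A' l w - A l w| ≤ dA * Real.exp (-κ * l1 (x' - quo N w)))
    (hdB : ∀ l' y, |B' l' y - B l' y| ≤ dB * Real.exp (-κ * l1 (quo N y - z')))
    (hdH : ∀ κ'' u, |H' κ'' u - H κ'' u| ≤ dH * Real.exp (-κ * l1 (quo N u - u')))
    (hTw : ∀ κ'' u w l y l', T κ'' u w l y l' ≠ 0 → w ∈ Sw y) (hTu : ∀ κ'' u w l y l', T κ'' u w l y l' ≠ 0 → u ∈ Su y)
    (hRw : ∀ y, ∀ w ∈ Sw y, l1 (w - y) ≤ RW) (hRu : ∀ y, ∀ u ∈ Su y, l1 (u - y) ≤ RU)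
    (hmass : ∀ y l', ∑ w ∈ Sw y, ∑ l, ∑ κ'', ∑ u ∈ Su y, |T κ'' u w l y l'| ≤ Mass) :
    |(∑' y : Site (d + 1), ∑ l', (∑' w, ∑ l, A' l w * ∑ κ'', ((N : ℝ) ^ (d + 1))⁻¹ * ∑' u, H' κ'' u * T κ'' u w l y l') * B' l' y) -
        ∑' y : Site (d + 1), ∑ l', (∑' w, ∑ l, A l w * ∑ κ'', ((N : ℝ) ^ (d + 1))⁻¹ * ∑' u, H κ'' u * T κ'' u w l y l') * B l' y| ≤
      (d + 1) * ((dA * CB' * CH' + CA * CB' * dH + CA * dB * CH) * Mass *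
          (Real.exp (κ * (RW / N + (d + 1))) * Real.exp (κ * (RU / N + (d + 1))))) *
        Zl (d + 1) (κ / 2) * Real.exp (-(κ / 2) * (l1 (x' - u') + l1 (z' - u'))) := by
  set c : ℝ := ((N : ℝ) ^ (d + 1))⁻¹ with hc
  -- summability of the five sandwiches involved
  have s' := sandwich_summable (N := N) (T := T) hκ hA' hB' hH' hTw hTu hRw hRu hmass
  have s := sandwich_summable (N := N) (T := T) hκ hA hB hH hTw hTu hRw hRu hmass
  have s1 := sandwich_summable (N := N) (T := T) (A := fun l w => A' l w - A l w) hκ hdA hB' hH' hTw hTu hRw hRu hmass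
  have s2 := sandwich_summable (N := N) (T := T) (H := fun μ v => H' μ v - H μ v) hκ hA hB' hdH hTw hTu hRw hRu hmass
  have s3 := sandwich_summable (N := N) (T := T) (B := fun l' y => B' l' y - B l' y) hκ hA hdB hH hTw hTu hRw hRu hmass
  have b1 := sandwich_bound (N := N) (T := T) (A := fun l w => A' l w - A l w) hκ hdA hB' hH' hTw hTu hRw hRu hmass
  have b2 := sandwich_bound (N := N) (T := T) (H := fun μ v => H' μ v - H μ v) hκ hA hB' hdH hTw hTu hRw hRu hmass
  have b3 := sandwich_bound (N := N) (T := T) (B := fun l' y => B' l' y - B l' y) hκ hA hdB hH hTw hTu hRw hRu hmass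
  rw [← s'.tsum_sub s]
  have hpt : ∀ y : Site (d + 1),
      (∑ l', (∑' w, ∑ l, A' l w * ∑ κ'', c * ∑' u, H' κ'' u * T κ'' u w l y l') * B' l' y) -
          (∑ l', (∑' w, ∑ l, A l w * ∑ κ'', c * ∑' u, H κ'' u * T κ'' u w l y l') * B l' y) =
        (∑ l', (∑' w, ∑ l, (A' l w - A l w) * ∑ μ, c * ∑' v, H' μ v * T μ v w l y l') * B' l' y) +
        (∑ l', (∑' w, ∑ l, A l w * ∑ μ, c * ∑' v, (H' μ v - H μ v) * T μ v w l y l') * B' l' y) +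
        (∑ l', (∑' w, ∑ l, A l w * ∑ μ, c * ∑' v, H μ v * T μ v w l y l') * (B' l' y - B l' y)) :=
    fun y => term_sub₃ hTw hTu c y
  rw [tsum_congr hpt, (s1.add s2).tsum_add s3, s1.tsum_add s2]
  have hZ : 0 ≤ Zl (d + 1) (κ / 2) := by unfold ExpKernelCalculus.Zl; exact tsum_nonneg fun _ => (Real.exp_pos _).le
  calc _ ≤ |(∑' y : Site (d + 1), ∑ l', (∑' w, ∑ l, (A' l w - A l w) * ∑ μ, c * ∑' v, H' μ v * T μ v w l y l') * B' l' y) +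
          ∑' y : Site (d + 1), ∑ l', (∑' w, ∑ l, A l w * ∑ μ, c * ∑' v, (H' μ v - H μ v) * T μ v w l y l') * B' l' y| +
        |∑' y : Site (d + 1), ∑ l', (∑' w, ∑ l, A l w * ∑ μ, c * ∑' v, H μ v * T μ v w l y l') * (B' l' y - B l' y)| :=
        abs_add_le _ _
    _ ≤ (|∑' y : Site (d + 1), ∑ l', (∑' w, ∑ l, (A' l w - A l w) * ∑ μ, c * ∑' v, H' μ v * T μ v w l y l') * B' l' y| +
          |∑' y : Site (d + 1), ∑ l', (∑' w, ∑ l, A l w * ∑ μ, c * ∑' v, (H' μ v - H μ v) * T μ v w l y l') * B' l' y|) +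
        |∑' y : Site (d + 1), ∑ l', (∑' w, ∑ l, A l w * ∑ μ, c * ∑' v, H μ v * T μ v w l y l') * (B' l' y - B l' y)| := by
        gcongr; exact abs_add_le _ _
    _ ≤ _ := by
        refine ((add_le_add (add_le_add b1 b2) b3)).trans (le_of_eq ?_)
        ring

end Trilinear


/-! ## §2 Scalars through the vertex leg; the vertex leg of a generic coarse 1-form -/

section Scalar

variable {N : ℕ} {A B H : Fin (d + 1) → Site (d + 1) → ℝ}
  {T : Fin (d + 1) → Site (d + 1) → Site (d + 1) → Fin (d + 1) → Site (d + 1) → Fin (d + 1) → ℝ}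

/-- [folklore] A scalar on the vertex leg factors out of the sandwich (no summability needed: `tsum_mul_left` over `ℝ`). -/
theorem sandwich_const_mul_vertex (c c₀ : ℝ) :
    (∑' y : Site (d + 1), ∑ l', (∑' w, ∑ l, A l w * ∑ μ, c * ∑' v, (c₀ * H μ v) * T μ v w l y l') * B l' y) =
      c₀ * ∑' y : Site (d + 1), ∑ l', (∑' w, ∑ l, A l w * ∑ μ, c * ∑' v, H μ v * T μ v w l y l') * B l' y := by
  have hv : ∀ μ w l y l', ∑' v, (c₀ * H μ v) * T μ v w l y l' = c₀ * ∑' v, H μ v * T μ v w l y l' := by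
    intro μ w l y l'
    rw [← tsum_mul_left]
    exact tsum_congr fun v => by ring
  have hμ : ∀ w l y l', ∑ μ, c * ∑' v, (c₀ * H μ v) * T μ v w l y l' = c₀ * ∑ μ, c * ∑' v, H μ v * T μ v w l y l' := by
    intro w l y l'
    rw [Finset.mul_sum]
    exact Finset.sum_congr rfl fun μ _ => by rw [hv]; ring
  have hw : ∀ y l', ∑' w, ∑ l, A l w * ∑ μ, c * ∑' v, (c₀ * H μ v) * T μ v w l y l' =
      c₀ * ∑' w, ∑ l, A l w * ∑ μ, c * ∑' v, H μ v * T μ v w l y l' := by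
    intro y l'
    rw [← tsum_mul_left]
    refine tsum_congr fun w => ?_
    rw [Finset.mul_sum]
    exact Finset.sum_congr rfl fun l _ => by rw [hμ]; ring
  rw [← tsum_mul_left]
  refine tsum_congr fun y => ?_
  rw [Finset.mul_sum]
  exact Finset.sum_congr rfl fun l' _ => by rw [hw]; ring

end Scalar

section Vertex

open AffineReproduction (contourSumAdj)
open AffineAveraging (Form1 unitVec)
open Summit.QuantumFields.BalabanUV.Beta.GAN24.TaylorLamVertexPairing (abs_contourSumAdj_le_exp quo_quo)

/-- [folklore] `𝒬ᵀ_R` is linear: differences. -/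
theorem contourSumAdj_sub {D : ℕ} (R : ℕ) (φ ψ : Form1 D ℝ) (μ : Fin D) (Y : Site D) :
    contourSumAdj R (fun κ q => φ κ q - ψ κ q) μ Y = contourSumAdj R φ μ Y - contourSumAdj R ψ μ Y := by
  simp only [contourSumAdj, Finset.sum_sub_distrib]

/-- [folklore] `𝒬ᵀ_R` is linear: scalars. -/
theorem contourSumAdj_const_mul {D : ℕ} (R : ℕ) (c : ℝ) (φ : Form1 D ℝ) (μ : Fin D) (Y : Site D) :
    contourSumAdj R (fun κ q => c * φ κ q) μ Y = c * contourSumAdj R φ μ Y := by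
  simp only [contourSumAdj, Finset.mul_sum]

/-- [folklore] `onLat` of a pointwise difference (real-valued families). -/
theorem onLat_sub_apply (N' : ℕ) (f g : Site (d + 1) → ℝ) (v : Site (d + 1)) :
    onLat N' (fun Y => f Y - g Y) v = onLat N' f v - onLat N' g v := by
  by_cases hv : Torus.proj N' v = 0
  · simp only [onLat, hv, if_true]
  · simp only [onLat, hv, if_false, sub_zero]

/-- [folklore] `onLat` of a scalar multiple (real-valued families). -/
theorem onLat_const_mul_apply (N' : ℕ) (c : ℝ) (f : Site (d + 1) → ℝ) (v : Site (d + 1)) :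
    onLat N' (fun Y => c * f Y) v = c * onLat N' f v := by
  by_cases hv : Torus.proj N' v = 0
  · simp only [onLat, hv, if_true]
  · simp only [onLat, hv, if_false, mul_zero]

/-- [folklore] **THE VERTEX LEG OF A GENERIC COARSE 1-FORM** (twin of leaf-18's `abs_vertexLeg_le` for an arbitrary `φ`): for
`N = N′·R` and `|φ κ q| ≤ C·e^{−κ|q − u′|₁}`, `|onLat N′ (e·𝒬ᵀ_R φ μ) v| ≤ |e|·R·C·e^{κ}·e^{−κ|quo N v − u′|₁}`. -/
theorem abs_onLat_contourSumAdj_le {N N' R : ℕ} [NeZero N] [NeZero N'] (hN : N = N' * R) (μ : Fin (d + 1))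
    (u' v : Site (d + 1)) (e : ℝ) (φ : Form1 (d + 1) ℝ) {C κ : ℝ} (hκ : 0 ≤ κ) (hC : 0 ≤ C)
    (hφ : ∀ κ₁ q, |φ κ₁ q| ≤ C * Real.exp (-κ * l1 (q - u'))) :
    |onLat N' (fun Y => e * contourSumAdj R φ μ Y) v| ≤ |e| * (R * (C * Real.exp κ)) * Real.exp (-κ * l1 (quo N v - u')) := by
  have hR : NeZero R := ⟨by rintro rfl; exact NeZero.ne N (by rw [hN, mul_zero])⟩
  by_cases hv : Torus.proj N' v = 0
  · simp only [onLat, hv, if_true, abs_mul]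
    have h := abs_contourSumAdj_le_exp R φ u' hκ hφ μ (quo N' v)
    rw [quo_quo, ← hN] at h
    calc |e| * |contourSumAdj R φ μ (quo N' v)| ≤ |e| * (R * (C * Real.exp κ * Real.exp (-κ * l1 (quo N v - u')))) :=
          mul_le_mul_of_nonneg_left h (abs_nonneg e)
      _ = _ := by ring
  · rw [onLat_off _ hv, abs_zero]
    positivity

end Vertex

/-! ## §3 The Λ-table instance of the three-leg telescoping bound -/

/-- [folklore] **THREE-LEG TELESCOPING OF THE Λ SANDWICH WITH ABSTRACT LEGS** (member `N = Lc^{ℓ+k+1}`, level `M = Lc^ℓ`, inner blocking `N′ = Lc^{ℓ+1}`; `Mass(ℓ) = #S_w(ℓ)·(d+1)²·#box_Y·2ℓ(Lc)²∕M^{2(d+1)}` from leaf-18's `table_mass_le`):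
`|SW(A′,H′,B′) − SW(A,H,B)| ≤ (d+1)·(dA·CB′·CH′ + CA·CB′·dH + CA·dB·CH)·Mass(ℓ)·K_W·K_U·Zl_{d+1}(κ∕2)·e^{−(κ∕2)(|x′−u′|₁+|z′−u′|₁)}`. -/
theorem lamSandwich_sub_le (ℓ k p : ℕ) (hp : p = ℓ + k + 1) {κ CA CB CH CA' CB' CH' dA dB dH : ℝ} (hκ : 0 < κ)
    {x' u' z' : Site (d + 1)} {A B H A' B' H' : Fin (d + 1) → Site (d + 1) → ℝ}
    (hA : ∀ l w, |A l w| ≤ CA * Real.exp (-κ * l1 (x' - quo (Lc ^ p) w)))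
    (hB : ∀ l' y, |B l' y| ≤ CB * Real.exp (-κ * l1 (quo (Lc ^ p) y - z')))
    (hH : ∀ μ v, |H μ v| ≤ CH * Real.exp (-κ * l1 (quo (Lc ^ p) v - u')))
    (hA' : ∀ l w, |A' l w| ≤ CA' * Real.exp (-κ * l1 (x' - quo (Lc ^ p) w)))
    (hB' : ∀ l' y, |B' l' y| ≤ CB' * Real.exp (-κ * l1 (quo (Lc ^ p) y - z')))
    (hH' : ∀ μ v, |H' μ v| ≤ CH' * Real.exp (-κ * l1 (quo (Lc ^ p) v - u')))
    (hdA : ∀ l w, |A' l w - A l w| ≤ dA * Real.exp (-κ * l1 (x' - quo (Lc ^ p) w)))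
    (hdB : ∀ l' y, |B' l' y - B l' y| ≤ dB * Real.exp (-κ * l1 (quo (Lc ^ p) y - z')))
    (hdH : ∀ μ v, |H' μ v - H μ v| ≤ dH * Real.exp (-κ * l1 (quo (Lc ^ p) v - u'))) :
    |(∑' y : Site (d + 1), ∑ l' : Fin (d + 1),
        (∑' w : Site (d + 1), ∑ l : Fin (d + 1), A' l w *
            ∑ μ : Fin (d + 1), ((((Lc ^ p : ℕ) : ℝ)) ^ (d + 1))⁻¹ * ∑' v : Site (d + 1),
              H' μ v * onLat (Lc ^ (ℓ + 1)) (fun Y => avgLift (Lc ^ ℓ) (hessFF Lc μ Y)) v w y (Sum.inl l) (Sum.inl l')) * B' l' y) -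
      ∑' y : Site (d + 1), ∑ l' : Fin (d + 1),
        (∑' w : Site (d + 1), ∑ l : Fin (d + 1), A l w *
            ∑ μ : Fin (d + 1), ((((Lc ^ p : ℕ) : ℝ)) ^ (d + 1))⁻¹ * ∑' v : Site (d + 1),
              H μ v * onLat (Lc ^ (ℓ + 1)) (fun Y => avgLift (Lc ^ ℓ) (hessFF Lc μ Y)) v w y (Sum.inl l) (Sum.inl l')) * B l' y| ≤
      ((d : ℝ) + 1) * ((dA * CB' * CH' + CA * CB' * dH + CA * dB * CH) *
          ((((2 * (2 * (2 * (d + 1) * (Lc + 1) * Lc ^ ℓ)) + 1) ^ (d + 1) : ℕ) : ℝ) * (((d : ℝ) + 1) * (((d : ℝ) + 1) *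
            ((((2 * (4 * (d + 1) + 1) + 1) ^ (d + 1) : ℕ) : ℝ) * (2 * (ell (d + 1) Lc : ℝ) ^ 2 / ((Lc : ℝ) ^ ℓ) ^ (2 * (d + 1))))))) *
          (Real.exp (κ * (((d : ℝ) + 1) * (4 * ((d : ℝ) + 1) * (Lc + 1)) + (d + 1))) *
            Real.exp (κ * (((d : ℝ) + 1) * ((4 * ((d : ℝ) + 1) + 1) + 1) + (d + 1))))) *
        Zl (d + 1) (κ / 2) * Real.exp (-(κ / 2) * (l1 (x' - u') + l1 (z' - u'))) := by
  subst hp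
  have hL0 : (0 : ℝ) < Lc := by exact_mod_cast Nat.pos_of_ne_zero (NeZero.ne Lc)
  have hL1 : (1 : ℝ) ≤ Lc := by exact_mod_cast (Nat.one_le_iff_ne_zero.2 (NeZero.ne Lc))
  haveI hN0 : NeZero (Lc ^ (ℓ + k + 1)) := ⟨pow_ne_zero _ (NeZero.ne Lc)⟩
  haveI hNp0 : NeZero (Lc ^ (ℓ + 1)) := ⟨pow_ne_zero _ (NeZero.ne Lc)⟩
  haveI hM0 : NeZero (Lc ^ ℓ) := ⟨pow_ne_zero _ (NeZero.ne Lc)⟩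
  have hNp : Lc ^ (ℓ + 1) = Lc ^ ℓ * Lc := pow_succ Lc ℓ
  have hcast : (((Lc ^ (ℓ + k + 1) : ℕ) : ℝ)) = (Lc : ℝ) ^ (ℓ + k + 1) := by push_cast; rfl
  have hcastP : (((Lc ^ (ℓ + 1) : ℕ) : ℝ)) = (Lc : ℝ) ^ (ℓ + 1) := by push_cast; rfl
  have hcastM : (((Lc ^ ℓ : ℕ) : ℝ)) = (Lc : ℝ) ^ ℓ := by push_cast; rfl
  set RWn : ℕ := 2 * (2 * (d + 1) * (Lc + 1) * Lc ^ ℓ) with hRWn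
  set RW : ℝ := ((d : ℝ) + 1) * (4 * ((d : ℝ) + 1) * (Lc + 1)) * ((Lc ^ (ℓ + k + 1) : ℕ) : ℝ) with hRW
  set RU : ℝ := ((d : ℝ) + 1) * ((4 * ((d : ℝ) + 1) + 1) + 1) * ((Lc ^ (ℓ + k + 1) : ℕ) : ℝ) with hRU
  have hS := sandwich_sub_le (d := d) (N := Lc ^ (ℓ + k + 1)) (κ := κ) (CA := CA) (CB := CB) (CH := CH)
    (CA' := CA') (CB' := CB') (CH' := CH') (dA := dA) (dB := dB) (dH := dH)
    (Mass := (((2 * RWn + 1) ^ (d + 1) : ℕ) : ℝ) * (((d : ℝ) + 1) * (((d : ℝ) + 1) *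
      ((((2 * (4 * (d + 1) + 1) + 1) ^ (d + 1) : ℕ) : ℝ) * (2 * (ell (d + 1) Lc : ℝ) ^ 2 / (((Lc ^ ℓ : ℕ) : ℝ)) ^ (2 * (d + 1)))))))
    (RW := RW) (RU := RU) (x' := x') (u' := u') (z' := z') (A := A) (B := B) (H := H) (A' := A') (B' := B') (H' := H')
    (T := fun μ v w l y l' => onLat (Lc ^ (ℓ + 1)) (fun Y => avgLift (Lc ^ ℓ) (hessFF Lc μ Y)) v w y (Sum.inl l) (Sum.inl l'))
    (Sw := fun y => Fintype.piFinset fun j => Finset.Icc (y j - RWn) (y j + RWn))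
    (Su := fun y => (Fintype.piFinset fun j =>
        Finset.Icc (quo (Lc ^ (ℓ + 1)) y j - (4 * (d + 1) + 1 : ℕ)) (quo (Lc ^ (ℓ + 1)) y j + (4 * (d + 1) + 1 : ℕ))).image
      (fun Y : Site (d + 1) => ((Lc ^ (ℓ + 1) : ℕ) : ℤ) • Y))
    hκ hA hB hH hA' hB' hH' hdA hdB hdH
    (fun μ v w l y l' hne => mem_boxW_of_ne_zero (Lc := Lc) (Lc ^ (ℓ + 1)) (Lc ^ ℓ) hne)
    (fun μ v w l y l' hne => mem_imageY_of_ne_zero (Lc := Lc) (Lc ^ (ℓ + 1)) (Lc ^ ℓ) hNp hne)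
    (fun y w hw => by
      have h := l1_le_of_mem_box hw
      have hle : ((d : ℝ) + 1) * RWn ≤ RW := by
        rw [hRW, hRWn, hcast]
        push_cast
        have hmono : ((Lc : ℝ) ^ ℓ) ≤ (Lc : ℝ) ^ (ℓ + k + 1) := pow_le_pow_right₀ hL1 (by omega)
        nlinarith [hmono, show (0 : ℝ) ≤ ((d : ℝ) + 1) * (4 * ((d : ℝ) + 1) * (Lc + 1)) by positivity]
      exact h.trans hle)
    (fun y v hv => by
      have h := l1_le_of_mem_imageY (d := d) (Lc ^ (ℓ + 1)) hv
      have hle : ((d : ℝ) + 1) * ((Lc ^ (ℓ + 1) : ℕ) : ℝ) * ((4 * (d + 1) + 1 : ℕ) + 1) ≤ RU := by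
        rw [hRU, hcastP, hcast]
        push_cast
        have hmono : ((Lc : ℝ) ^ (ℓ + 1)) ≤ (Lc : ℝ) ^ (ℓ + k + 1) := pow_le_pow_right₀ hL1 (by omega)
        nlinarith [hmono, show (0 : ℝ) ≤ ((d : ℝ) + 1) * ((4 * ((d : ℝ) + 1) + 1) + 1) by positivity]
      exact h.trans hle)
    (fun y l' => table_mass_le (Lc := Lc) (Lc ^ (ℓ + 1)) (Lc ^ ℓ) y l' RWn)
  have hNpos : (0 : ℝ) < ((Lc ^ (ℓ + k + 1) : ℕ) : ℝ) := by rw [hcast]; positivity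
  have hRW' : RW / ((Lc ^ (ℓ + k + 1) : ℕ) : ℝ) = ((d : ℝ) + 1) * (4 * ((d : ℝ) + 1) * (Lc + 1)) := by
    rw [hRW]; field_simp
  have hRU' : RU / ((Lc ^ (ℓ + k + 1) : ℕ) : ℝ) = ((d : ℝ) + 1) * ((4 * ((d : ℝ) + 1) + 1) + 1) := by
    rw [hRU]; field_simp
  rw [hRW', hRU', hcastM] at hS
  exact hS

end Summit.QuantumFields.BalabanUV.Beta.GAN24.TaylorDiffLam
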